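import Summits.QuantumFields.QCD.Theses.GaussianLinkFrames
import Summits.QuantumFields.QCD.Theorems.PauliWegnerSeaFMClosureUnquenchedRepairedC2
import Summits.QuantumFields.QCD.Theorems.PauliWegnerSeaFMClosureUnquenchedSplitC3
import Summits.QuantumFields.QCD.Theorems.PauliWegnerSeaFMClosureUnquenchedTwoStarC1
import Summits.QuantumFields.QCD.Theorems.PauliWegnerSeaFMClosureUnquenchedSideWitnessC1
import Summits.QuantumFields.QCD.Cruxes.FMClosureUnquenched.K2Split
import Summits.QuantumFields.QCD.Cruxes.FrameFMClosure.Lines.sibling_graft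
import Summits.QuantumFields.QCD.Cruxes.FrameFMClosure.Lines.defect_ratio_sketch

/-!
# PARKED line record — idea `defect-ratio-tame-line`, crux `GaussianLinkFrames.FrameFMClosure` (stmt-QuantumFields-17375)

crux-plan seat `planner-cruxplan-stmt-QuantumFields-17375-defect-ratio-tame-li-0`, 2026-08-17.
Outcome of the seat: **no-skeleton** (see `Lines/defect-ratio-tame-line.md`).  This file is NOT a registered
skeleton: it has NO `stub_*` and NO `sorry`.  It records, kernel-checked, the three facts the no-skeleton verdict
rests on, and parks the SOUND typing of the tame line for whoever lines the restated / split crux: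

* §1 **Typing repair.**  The ideator's `DefectRatio.MixedFarStability` / `DepletedToFullMean`
  (`Lines/defect_ratio_sketch.lean`) are pure inequalities between `pqE`-values whose left sides carry a DEPLETED
  (ball-complement) factor.  `pqE` is a ratio of Bochner integrals, so on a NON-integrable functional it takes the
  junk value `0` (`pqE_eq_zero_of_not_integrable`) and every such inequality instance is vacuously true
  (`pqE_le_of_not_integrable`).  (The full-factor / defect-ratio functionals of `DefectRatioFrac` are bounded and
  continuous, hence always integrable — the tame point; the defect is confined to the depleted factor.)  The intended proof of the
  composition `TameCoreOutward` integrates the a.e. forward identity (Rfwd) term by term (landed pattern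
  `VonMisesCirclesC1.c1_exterior_le`), which needs (Tinv) a.e. invertibility of the ball-complement side matrices —
  a THEOREM, K1♭-free (`tinv_ballCompl` below, from `fibreBandLaw_holds` + `c1_sideWitness`) — AND integrability
  of `‖det‖·bn(gside (ball r)ᶜ D)^{s₁}·bn(D⁻¹)^{s₂}` at a k-UNIFORM exponent, which is clause (T0) of the
  existing package (`tameNoJunk_of_twoStarBounds`), proved in the tree only through K1♭ on two-star fibres.
  Hence the sound tame package is `TamePackage := TameNoJunk ∧ DefectRatioFrac` — part of `TwoStarBounds` returns.
* §2 **What a concluding skeleton is forced to assume.**  With the tame stubs typed soundly, the crux AS TYPED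
  follows only together with the two corner children of the sibling crux's prepared split
  (`Cruxes/FMClosureUnquenched/SPLIT.md`): `Split.CoreInward` (A6) and `∀ N_f, UnitShellLowerBound N_f` (A5)
  — `frameFMClosure_of_parked`, real proof via the landed merge `VonMisesCirclesC3.conclusion_of_outward_of_inward`.
  Neither child is touched by the idea (card §Disproof used: "inherited corner, not solved"); they are the stub at
  which eleven lines of the byte-identical Core died (`Lines/Sketch-dead.md`, common wall).
* §3 **Where the line lives after a restatement.**  From `InputTwo` (`2 ≤ ℓ₀`) the same tame stubs give R1
  `SiblingGraft.FrameFMClosureOutward` with NO corner (`frameFMClosureOutward_of_parked`), i.e. the tame triple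
  + `TameClosureTwo` is an alternative decomposition of the OUTWARD core, competing with the landed
  `closure_from_two` / `coreOutward_of_twoStarBounds_farStability` for {`TwoStarBounds`, `FarStability`}.

Vocabulary: `VonMisesCircles.*` (landed Defs), `SiblingGraft.InputTwo/OutwardConclusion/FrameFMClosureOutward`
(`Lines/sibling_graft.lean` §4), `Split.ConclusionOutward/CoreInward` (`Cruxes/FMClosureUnquenched/K2Split.lean`),
`DefectRatio.*` (`Lines/defect_ratio_sketch.lean`).
-/

noncomputable section

namespace Summit.QuantumFields.QCD.Cruxes.FrameFMClosure.DefectRatioTameLine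

open scoped BigOperators
open MeasureTheory Filter
open Literature.MathematicalPhysics.QuantumFieldTheory Literature.MathematicalPhysics.QuantumLattice
  Literature.Probability.LatticeModels
open Summit.QuantumFields.QCD.Theorems.VonMisesCircles
open Summit.QuantumFields.QCD.Theorems.VonMisesCirclesC1
open Summit.QuantumFields.QCD.Theorems.VonMisesCirclesC2
open Summit.QuantumFields.QCD.Theorems.VonMisesCirclesC3
open Summit.QuantumFields.QCD.Cruxes.FMClosureUnquenched
open Summit.QuantumFields.QCD.Cruxes.FrameFMClosure.DefectRatio

/-! ## §0 The junk value of `pqE` -/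

/-- `pqE` of a functional whose `‖det‖`-weighted version is not integrable is the junk value `0`. [folklore] -/
theorem pqE_eq_zero_of_not_integrable {Nf S : ℕ} (β : ℝ) (mq : Fin Nf → ℝ)
    (F : GaugeConfig 4 (2 * S + 1) (Matrix.specialUnitaryGroup (Fin 3) ℂ) → ℝ)
    (h : ¬ Integrable (fun U => ‖(diracMatrix U mq).det‖ * F U) (wilsonMeasure (fundamentalRep (Fin 3)) β)) :
    pqE Nf S β mq F = 0 := by
  unfold pqE
  rw [integral_undef h, zero_div]

/-- Hence every upper bound with a non-negative right side holds VACUOUSLY for such a functional — this is how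
`DepletedToFullMean` / `MixedFarStability` as typed in the Sketch can be true without content wherever the
depleted factor's weighted `s`-moment fails to be integrable. [folklore] -/
theorem pqE_le_of_not_integrable {Nf S : ℕ} (β : ℝ) (mq : Fin Nf → ℝ)
    (F : GaugeConfig 4 (2 * S + 1) (Matrix.specialUnitaryGroup (Fin 3) ℂ) → ℝ)
    (h : ¬ Integrable (fun U => ‖(diracMatrix U mq).det‖ * F U) (wilsonMeasure (fundamentalRep (Fin 3)) β))
    {R : ℝ} (hR : 0 ≤ R) : pqE Nf S β mq F ≤ R := by
  rw [pqE_eq_zero_of_not_integrable β mq F h]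
  exact hR

/-! ## §1 The sound tame package -/

/-- **(T0-tame) no junk**: integrability, against the phase-quenched weight, of ONE depleted factor on a ball
complement times ONE full factor (exponents in `[0, s₀]`, so each factor alone is included) — exactly the
functionals the one-cut bootstrap integrates ((Rfwd) step, `MixedFarStability`, `DepletedToFullMean`). -/
def TameNoJunk (Nf : ℕ) : Prop :=
  ∃ s₀ : ℝ, 0 < s₀ ∧ ∀ (β : ℝ) (mq : Fin Nf → ℝ) (f : Fin Nf), -9 ≤ mq f → mq f ≤ 1 → ∀ (S : ℕ),
    ∀ (s₁ s₂ : ℝ), 0 ≤ s₁ → s₁ ≤ s₀ → 0 ≤ s₂ → s₂ ≤ s₀ →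
      ∀ (x : TorusSite 4 (2 * S + 1)) (r : ℕ), 1 ≤ r → r + 1 ≤ S →
        ∀ (a b c d : TorusSite 4 (2 * S + 1)),
          Integrable (fun U : GaugeConfig 4 (2 * S + 1) (Matrix.specialUnitaryGroup (Fin 3) ℂ) =>
              ‖(diracMatrix U mq).det‖ *
                (blockNorm (gside (ball S x r)ᶜ (wilsonD U (mq f))) a b ^ s₁ *
                  blockNorm (wilsonD U (mq f))⁻¹ c d ^ s₂))
            (wilsonMeasure (fundamentalRep (Fin 3)) β)

/-- **The sound tame a-priori package** (what stub 1 of the line would be): no junk ∧ the fractional defect ratio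
(= clause (T5) entry-wise, triage r1-1/r1-2 sharpen 1: the `s = 1` member `DefectRatioBound` is off the critical path). -/
def TamePackage (Nf : ℕ) : Prop := TameNoJunk Nf ∧ DefectRatioFrac Nf

/-- The no-junk clause is a sub-clause of the EXISTING averaged package: (T0) of `TwoStarBounds` with
`A₁ = (ball x r)ᶜ`, `A₂ = A₃ = univ`. [folklore] -/
theorem tameNoJunk_of_twoStarBounds {Nf : ℕ} (h : TwoStarBounds Nf) : TameNoJunk Nf := by
  obtain ⟨s₀, C, p, hs₀, _hs₀1, _hC, hT⟩ := h
  refine ⟨s₀, hs₀, fun β mq f hm9 hm1 S s₁ s₂ hs₁0 hs₁ hs₂0 hs₂ x r hr1 hrS a b c d => ?_⟩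
  obtain ⟨-, hT0, -⟩ := hT s₀ hs₀ le_rfl β mq f hm9 hm1 S
  have hA : AdmissibleSide S (ball S x r)ᶜ := Or.inr ⟨x, r, hr1, hrS, Or.inr (Or.inr rfl)⟩
  have h3 := hT0 s₁ s₂ 0 hs₁0 hs₁ hs₂0 hs₂ le_rfl hs₀.le (ball S x r)ᶜ Finset.univ Finset.univ hA (Or.inl rfl)
    (Or.inl rfl) a b c d c d
  simpa only [gside_univ, Real.rpow_zero, mul_one] using h3

/-- **(Tinv) for ball complements is a theorem, K1♭-free**: for probe masses in `[-9, 1]`, `1 ≤ r`, `r + 1 ≤ S`,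
the side matrix of `(ball x r)ᶜ` is invertible for `μ_W(β)`-a.e. field (fibre band law on the whole torus seeded by
the landed side witness). [folklore] -/
theorem tinv_ballCompl {S : ℕ} (β m₀ : ℝ) (hm₁ : -9 ≤ m₀) (hm₂ : m₀ ≤ 1) (x : TorusSite 4 (2 * S + 1)) (r : ℕ)
    (hr1 : 1 ≤ r) (hrS : r + 1 ≤ S) :
    ∀ᵐ U ∂(wilsonMeasure (d := 4) (L := 2 * S + 1) (fundamentalRep (Fin 3)) β),
      (sideMatrix (ball S x r)ᶜ (wilsonD U m₀)).det ≠ 0 :=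
  ae_sideMatrix_det_ne_zero fibreBandLaw_holds c1_sideWitness β m₀ hm₁ hm₂ _
    (Or.inr ⟨x, r, hr1, hrS, Or.inr (Or.inr rfl)⟩)

/-- … and so is (Tinv) for `D` itself (`A = univ`). [folklore] -/
theorem tinv_full {S : ℕ} (β m₀ : ℝ) (hm₁ : -9 ≤ m₀) (hm₂ : m₀ ≤ 1) :
    ∀ᵐ U ∂(wilsonMeasure (d := 4) (L := 2 * S + 1) (fundamentalRep (Fin 3)) β), (wilsonD U m₀).det ≠ 0 := by
  have h := ae_sideMatrix_det_ne_zero (S := S) fibreBandLaw_holds c1_sideWitness β m₀ hm₁ hm₂ Finset.univ (Or.inl rfl)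
  filter_upwards [h] with U hU
  simpa only [sideMatrix_univ] using hU

/-! ## §2 The tame closure (what stub 4 of the line would be) and the forced corner children -/

/-- **Tame closure from the input AS TYPED** (`1 ≤ ℓ₀`): the analogue of the landed `VonMisesCirclesC1.stub_closure`
with the tame triple in place of `TwoStarBounds ∧ FarStability`; like it, it must carry the A5 corner
`UnitShellLowerBound` to dispose of the unit shell at vanishing coupling. -/
def TameClosure : Prop :=
  ∀ (Nf : ℕ) (reg : QCDRegularisation Nf) (m : Fin Nf → ℝ), (∀ f, 0 < m f) →
    TamePackage Nf → MixedFarStability Nf → DepletedToFullMean Nf → CollarResolventBounds →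
      UnitShellLowerBound Nf → HoppingDecay Nf → Input Nf reg m →
        ∃ (s δ C K₀ : ℝ) (ℓ₀ : ℕ → Fin Nf → ℕ), OutwardDecayWith Nf reg m s δ C K₀ ℓ₀

/-- **Tame closure from the repaired input** (`2 ≤ ℓ₀`, no corner): the analogue of the landed `closure_from_two`. -/
def TameClosureTwo : Prop :=
  ∀ (Nf : ℕ) (reg : QCDRegularisation Nf) (m : Fin Nf → ℝ),
    TamePackage Nf → MixedFarStability Nf → DepletedToFullMean Nf → CollarResolventBounds → HoppingDecay Nf →
      SiblingGraft.InputTwo Nf reg m →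
        ∃ (s δ C K₀ : ℝ) (ℓ₀ : ℕ → Fin Nf → ℕ), OutwardDecayWith Nf reg m s δ C K₀ ℓ₀

/-- The A5 corner child (= `∀ N_f, VonMisesCircles.UnitShellLowerBound N_f` = 11512's split child `UnitShellSign`). -/
def UnitShellSign : Prop := ∀ Nf : ℕ, UnitShellLowerBound Nf

/-- An outward decay package is an outward-guarded conclusion (`K := K₀`). [folklore] -/
theorem conclusionOutward_of_outwardDecayWith {Nf : ℕ} (reg : QCDRegularisation Nf) (m : Fin Nf → ℝ)
    {s δ C K₀ : ℝ} {ℓ₀ : ℕ → Fin Nf → ℕ} (hout : OutwardDecayWith Nf reg m s δ C K₀ ℓ₀) :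
    Split.ConclusionOutward Nf reg m := by
  obtain ⟨hs0, hs1, hδ, _hC, hwin, -, hdec⟩ := hout
  refine ⟨s, δ, C, K₀, hs0, hs1, hδ, ?_⟩
  filter_upwards [hwin, hdec] with k hkwin hk S hS f v hv hfar
  have hℓ : (ℓ₀ k f : ℝ) ≤ ‖v‖ := by
    have ha : 0 < reg.a k := reg.a_pos k
    have h1 : (ℓ₀ k f : ℝ) * reg.a k ≤ reg.a k * ‖v‖ := (hkwin f).trans hfar
    nlinarith
  exact hk S hS f v hv hℓ

/-- R1's outward conclusion and the split's are the same text. -/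
theorem outwardConclusion_iff {Nf : ℕ} (reg : QCDRegularisation Nf) (m : Fin Nf → ℝ) :
    SiblingGraft.OutwardConclusion Nf reg m ↔ Split.ConclusionOutward Nf reg m := Iff.rfl

/-- **What a concluding skeleton for the crux AS TYPED must assume.**  The four tame stubs close
`FrameFMClosure` only together with the two corner children `UnitShellSign` (A5) and `Split.CoreInward` (A6);
the route hypothesis `FrameAPrioriBound` is introduced and never used.  Real proof: tame closure ⇒ outward
package ⇒ outward-guarded conclusion; `CoreInward` ⇒ inward conclusion; landed merge
`VonMisesCirclesC3.conclusion_of_outward_of_inward`. -/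
theorem frameFMClosure_of_parked
    (hT : ∀ Nf : ℕ, TamePackage Nf) (hM : ∀ Nf : ℕ, MixedFarStability Nf)
    (hD : ∀ Nf : ℕ, DepletedToFullMean Nf) (hclo : TameClosure) (hU : UnitShellSign) (hin : Split.CoreInward) :
    Summit.QuantumFields.QCD.Theses.GaussianLinkFrames.FrameFMClosure := by
  refine SiblingGraft.frame_iff.mpr fun _hFAB Nf reg m hm hInput => ?_
  obtain ⟨s, δ, C, K₀, ℓ₀, hout⟩ :=
    hclo Nf reg m hm (hT Nf) (hM Nf) (hD Nf) collarResolventBounds_holds (hU Nf) (hoppingDecay_holds Nf) hInput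
  exact Summit.QuantumFields.QCD.Theorems.VonMisesCirclesC3.conclusion_of_outward_of_inward reg m
    (conclusionOutward_of_outwardDecayWith reg m hout) (hin Nf reg m hm hInput)

/-- Conversely, nothing weaker than the corner children will do on the inward side: the crux AS TYPED already
contains `Split.CoreInward` (and the outward core), cf. `Split.split_of_core`. -/
theorem coreInward_of_frameFMClosure
    (hA : Summit.QuantumFields.QCD.Theses.GaussianLinkFrames.FrameAPrioriBound)
    (h : Summit.QuantumFields.QCD.Theses.GaussianLinkFrames.FrameFMClosure) : Split.CoreInward :=
  (Split.split_of_core (SiblingGraft.frame_iff.mp h hA)).2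

/-! ## §3 After a restatement: the tame line for the OUTWARD core, no corner -/

/-- **R1 from the tame stubs** (`InputTwo`, outward conclusion): the line the idea actually supports. -/
theorem frameFMClosureOutward_of_parked
    (hT : ∀ Nf : ℕ, TamePackage Nf) (hM : ∀ Nf : ℕ, MixedFarStability Nf)
    (hD : ∀ Nf : ℕ, DepletedToFullMean Nf) (hclo : TameClosureTwo) : SiblingGraft.FrameFMClosureOutward := by
  intro _hFAB Nf reg m _hm _hi hin
  obtain ⟨s, δ, C, K₀, ℓ₀, hout⟩ :=
    hclo Nf reg m (hT Nf) (hM Nf) (hD Nf) collarResolventBounds_holds (hoppingDecay_holds Nf) hin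
  exact (outwardConclusion_iff reg m).mpr (conclusionOutward_of_outwardDecayWith reg m hout)

/-- The same in the shape of the landed `coreOutward_of_twoStarBounds_farStability` (p149039) / the ideator's
`TameCoreOutward`, with the SOUND package in the antecedent. -/
theorem tameCoreOutward_of_parked
    (hT : ∀ Nf : ℕ, TamePackage Nf) (hM : ∀ Nf : ℕ, MixedFarStability Nf)
    (hD : ∀ Nf : ℕ, DepletedToFullMean Nf) (hclo : TameClosureTwo) :
    ∀ (Nf : ℕ) (reg : QCDRegularisation Nf) (m : Fin Nf → ℝ),
      SiblingGraft.InputTwo Nf reg m → Split.ConclusionOutward Nf reg m :=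
  fun Nf reg m hin => by
    obtain ⟨s, δ, C, K₀, ℓ₀, hout⟩ :=
      hclo Nf reg m (hT Nf) (hM Nf) (hD Nf) collarResolventBounds_holds (hoppingDecay_holds Nf) hin
    exact conclusionOutward_of_outwardDecayWith reg m hout

end Summit.QuantumFields.QCD.Cruxes.FrameFMClosure.DefectRatioTameLine

end
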